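import Literature.Analysis.FluidPDE.OnsagerBDSVEnergy
import Literature.Analysis.FluidPDE.OnsagerBDSVEnergyTools
import Literature.Analysis.FluidPDE.OnsagerBDSVPerturbationFlowBounds
import Literature.Analysis.FluidPDE.OnsagerBDSVThreeStagesProofs
import HarnessLib

/-!
# The BDSV energy estimate: discharge of the cross term (G₁)

Buckmaster–De Lellis–Székelyhidi–Vicol (BDSV), *Onsager's conjecture for admissible weak
solutions*, CPAM 72 (2019) = arXiv:1701.08678, proof of Prop. 6.2, first estimate: "By
integrating by parts once and using the identity [the curl form (5.28) of `w_{q+1}`] and the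
estimates [of Prop. 5.7] we obtain `|∫ w_{q+1}·v̄_q| ≤ … ≲ δ_q^{1/2} δ_{q+1}^{1/2} λ_q/λ_{q+1}`".
This file PROVES the named fact `BDSV.energy_crossTerm` (`OnsagerBDSVEnergy.lean`):
`BDSV.energy_crossTerm_holds`.

The printed argument, made quantitative: with `w_{q+1} = n_{q+1}⁻¹ curl Z` (`BDSV.perturbation`,
`Z = BDSV.potential`, `λ_{q+1} = 2π n_{q+1}`),
`∫ ⟪w_{q+1}, v̄_q⟫ = n_{q+1}⁻¹ ∫ ⟪Z, curl v̄_q⟫` (`BDSV.integral_inner_curl_comm`), so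
`|∫ ⟪w_{q+1}, v̄_q⟫| ≤ (2π/λ_{q+1}) ‖Z‖₀ ‖curl v̄_q‖₀`. Here `‖curl v̄_q‖₀ ≤ 6 C_in δ_q^{1/2} λ_q` by
(2.19)|_{N=0}, and `‖Z‖₀ ≤ (δ_{q+1}/c₀)^{1/2} · 9 e^{4C_in} · K_V`: at each point at most one
cut-off is active (`CutoffFamily.norm_sum_le`), `|ρ_{q,i}^{1/2}| ≤ (δ_{q+1}/c₀)^{1/2}` (Lemma 5.4:
`ρ_q ≤ δ_{q+1}`, `∑∫η_j² ≥ c₀`), `‖∇Φ_i‖_∞ ≤ e^{4 C_in ℓ^{2α}} ≤ e^{4C_in}` on `supp η_i` (Lemma 5.4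
via App. B, `PerturbationData.abs_partialDeriv_D_le_of_eta_ne_zero`), and the Mikado potential
`V` is bounded by `K_V = K_V(𝔚, C_in)` on the compact ball `‖R‖_∞ ≤ 9 e^{8C_in}(1 + 8C_in)` which
contains every `R̃_{q,i}(x,t)` with `η_i(x,t) ≠ 0` (from `ρ_q ≥ δ_{q+1}λ_q^{-α}/8`,
`‖R̊̄_q‖₀ ≤ C_in δ_{q+1} ℓ^α` and `λ_q^α ℓ^α ≤ 1`) — a cruder confinement than the membership
`R̃_{q,i} ∈ B̄_{1/2}(Id)` of Lemma 5.4, sufficient here. Altogether the constant is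
`C = 2π · 54 · e^{4C_in} K_V C_in / c₀^{1/2}` (with `C_in` replaced by `max(C_in, 0)`), the
threshold in `α` is `βb(b-1)` and the threshold in `a` is that of `4δ_{q+2} ≤ δ_{q+1} λ_q^{-α}`
(`BDSV.exists_threshold_four_amp`).

## References

* T. Buckmaster, C. De Lellis, L. Székelyhidi Jr., V. Vicol, *Onsager's conjecture for admissible
  weak solutions*, Comm. Pure Appl. Math. 72 (2019) 229–274 = arXiv:1701.08678: proof of
  Prop. 6.2 (first estimate); Lemma 5.4; §5.3 (5.28); App. B.
-/

open MeasureTheory Set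
open scoped NNReal ENNReal ContDiff InnerProductSpace Matrix Matrix.Norms.Elementwise

noncomputable section

namespace Literature.Analysis.FluidPDE

namespace BDSV

open FunctionSpaces FunctionSpaces.Torus

/-! ## Monotonicity of the standing hypotheses in the input constant -/

section Mono

variable {P : Params} {S : Setting} {Nbar : ℕ} {Cin Cin' C₀ : ℝ}

/-- The standing hypotheses with input constant `C_in` imply those with any larger constant (all
the scales multiplying `C_in` in (2.19)–(2.21) are nonnegative for `a ≥ 1`). [folklore] -/
theorem PerturbationHypotheses.mono_const (H : PerturbationHypotheses P S Nbar Cin C₀)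
    (ha : 1 ≤ P.a) (h : Cin ≤ Cin') : PerturbationHypotheses P S Nbar Cin' C₀ where
  pos_T := H.pos_T
  profile := H.profile
  eulerReynolds := H.eulerReynolds
  stress_support := H.stress_support
  velocity_sup := H.velocity_sup
  velocity N hN := (H.velocity N hN).mono (mul_le_mul_of_nonneg_right h
    (mul_nonneg (mul_nonneg (Real.sqrt_nonneg _) (freq_pos ha _).le)
      (Real.rpow_nonneg (mollScale_pos ha _).le _)))
  stress N hN := (H.stress N hN).mono (mul_le_mul_of_nonneg_right h
    (mul_nonneg (amp_pos ha _).le (Real.rpow_nonneg (mollScale_pos ha _).le _)))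
  transport N hN := (H.transport N hN).mono (mul_le_mul_of_nonneg_right h
    (mul_nonneg (mul_nonneg (mul_nonneg (amp_pos ha _).le (Real.sqrt_nonneg _))
      (freq_pos ha _).le) (Real.rpow_nonneg (mollScale_pos ha _).le _)))
  energy_gap := H.energy_gap

end Mono

/-! ## Pointwise bounds on the ingredients of the potential `Z` -/

section Pointwise

variable {P : Params} {S : Setting} {Nbar : ℕ} {Cin C₀ c₀ : ℝ} {Cη : ℕ → ℕ → ℝ}

/-- `λ_q^α ℓ^α ≤ 1` for `a, b ≥ 1`, `β, α ≥ 0` (`ℓ ≤ λ_q^{-1-3α/2}`; the exponent-`3α` version is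
`BDSV.freq_rpow_mul_mollScale_rpow_le_one` of `OnsagerBDSVGluedParams.lean`). [folklore] -/
private theorem freq_rpow_mul_mollScale_rpow_le_one₁ {β α a b : ℝ} (ha : 1 ≤ a) (hb : 1 ≤ b) (hβ : 0 ≤ β)
    (hα : 0 ≤ α) (q : ℕ) : freq a b q ^ α * mollScale β α a b q ^ α ≤ 1 := by
  have hf := freq_pos (b := b) ha q
  have h1f : 1 ≤ freq a b q := le_trans (by linarith [Real.two_le_pi]) (two_pi_le_freq ha q)
  have h1 := mollScale_rpow_le_mul ha hb hβ hα q
  have h2 : freq a b q ^ (-(3 * α ^ 2 / 2)) ≤ 1 :=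
    Real.rpow_le_one_of_one_le_of_nonpos h1f (by nlinarith [sq_nonneg α])
  calc freq a b q ^ α * mollScale β α a b q ^ α
      ≤ freq a b q ^ α * (freq a b q ^ (-α) * freq a b q ^ (-(3 * α ^ 2 / 2))) :=
        mul_le_mul_of_nonneg_left h1 (Real.rpow_nonneg hf.le _)
    _ = freq a b q ^ (-(3 * α ^ 2 / 2)) := by
        rw [← mul_assoc, ← Real.rpow_add hf, add_neg_cancel, Real.rpow_zero, one_mul]
    _ ≤ 1 := h2

/-- `ℓ^{2α} ≤ 1` for `a, b ≥ 1`, `β, α ≥ 0` (`ℓ ≤ λ_q^{-1} ≤ 1`). [folklore] -/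
theorem mollScale_rpow_two_mul_le_one {β α a b : ℝ} (ha : 1 ≤ a) (hb : 1 ≤ b) (hβ : 0 ≤ β)
    (hα : 0 ≤ α) (q : ℕ) : mollScale β α a b q ^ (2 * α) ≤ 1 := by
  have h1f : 1 ≤ freq a b q := le_trans (by linarith [Real.two_le_pi]) (two_pi_le_freq ha q)
  have hℓ : mollScale β α a b q ≤ 1 :=
    (mollScale_le_freq_inv ha hb hβ hα q).trans (inv_le_one_of_one_le₀ h1f)
  exact Real.rpow_le_one (mollScale_pos ha q).le hℓ (by linarith)

/-- **`‖∇Φ_i‖_∞ ≤ e^{4C_in}` on the support of `η_i`** (from Lemma 5.4 via App. B: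
`|∂ⱼ(Φ_i - id)_a| ≤ e^{4 C_in ℓ^{2α}} - 1` there, and `ℓ^{2α} ≤ 1`). [cite: BuckmasterEtAl2018, Lemma 5.4] -/
theorem PerturbationData.norm_gradPhi_le (H : PerturbationHypotheses P S Nbar Cin C₀)
    (𝒟 : PerturbationData P S c₀ Cη) (hCin : 0 ≤ Cin) (ha : 1 ≤ P.a) (hb : 1 ≤ P.b) (hβ : 0 ≤ P.β)
    (hα : 0 ≤ P.α) {i : ℕ} {t : ℝ} (ht : t ∈ Icc 0 S.T) {x' : UnitAddTorus (Fin 3)}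
    (hη : 𝒟.cut.η i t x' ≠ 0) (x : UnitAddTorus (Fin 3)) :
    ‖gradPhi 𝒟.D i t x‖ ≤ Real.exp (4 * Cin) := by
  have hpos : 0 ≤ Real.exp (4 * Cin) := (Real.exp_pos _).le
  rw [Matrix.norm_le_iff hpos]
  intro a j
  have hD := 𝒟.abs_partialDeriv_D_le_of_eta_ne_zero H hCin ha ht hη x a j
  have hℓ : mollScale P.β P.α P.a P.b S.q ^ (2 * P.α) ≤ 1 :=
    mollScale_rpow_two_mul_le_one ha hb hβ hα S.q
  have hexp : Real.exp (4 * (Cin * mollScale P.β P.α P.a P.b S.q ^ (2 * P.α))) ≤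
      Real.exp (4 * Cin) :=
    Real.exp_le_exp.2 (by nlinarith [mul_le_mul_of_nonneg_left hℓ hCin])
  have h1 : |(1 : Matrix (Fin 3) (Fin 3) ℝ) a j| ≤ 1 := by
    rw [Matrix.one_apply]; split_ifs <;> simp
  rw [Real.norm_eq_abs, gradPhi, Matrix.add_apply, Matrix.of_apply]
  calc |(1 : Matrix (Fin 3) (Fin 3) ℝ) a j + partialDeriv j (𝒟.D i t) x a|
      ≤ |(1 : Matrix (Fin 3) (Fin 3) ℝ) a j| + |partialDeriv j (𝒟.D i t) x a| := abs_add_le _ _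
    _ ≤ 1 + (Real.exp (4 * (Cin * mollScale P.β P.α P.a P.b S.q ^ (2 * P.α))) - 1) :=
        add_le_add h1 hD
    _ ≤ Real.exp (4 * Cin) := by linarith

/-- The sup bound `‖R̊̄_q(t,x)‖ ≤ C_in δ_{q+1} ℓ^α` read off (2.20)|_{N=0} (for `C_in ≥ 0`, `a ≥ 1`),
and with it the entry bound `‖ofCols R̊̄_q(t,x)‖_∞ ≤ C_in δ_{q+1} ℓ^α`. [cite: BuckmasterEtAl2018, §2.5 (2.20)] -/
theorem PerturbationHypotheses.norm_ofCols_Rbar_le (H : PerturbationHypotheses P S Nbar Cin C₀)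
    (hCin : 0 ≤ Cin) (ha : 1 ≤ P.a) {t : ℝ} (ht : t ∈ Icc 0 S.T) (x : UnitAddTorus (Fin 3)) :
    ‖ofCols (S.Rbar t x)‖ ≤
      Cin * (amp P.β P.a P.b (S.q + 1) * mollScale P.β P.α P.a P.b S.q ^ P.α) := by
  have hs := H.stress 0 (Nat.zero_le _) t ht
  simp only [Nat.cast_zero, neg_zero, zero_add] at hs
  have hB : 0 ≤ Cin * (amp P.β P.a P.b (S.q + 1) * mollScale P.β P.α P.a P.b S.q ^ P.α) :=
    mul_nonneg hCin (mul_nonneg (amp_pos ha _).le (Real.rpow_nonneg (mollScale_pos ha _).le _))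
  have hR : ‖S.Rbar t x‖ ≤
      Cin * (amp P.β P.a P.b (S.q + 1) * mollScale P.β P.α P.a P.b S.q ^ P.α) :=
    norm_le_of_eContDiffHolderNorm_zero_le hB hs x
  rw [Matrix.norm_le_iff hB]
  intro i j
  rw [ofCols_apply]
  calc ‖S.Rbar t x j i‖ ≤ ‖S.Rbar t x j‖ := by
        rw [Real.norm_eq_abs, ← Real.norm_eq_abs]
        exact PiLp.norm_apply_le (S.Rbar t x j) i |>.trans_eq' (by simp)
    _ ≤ ‖S.Rbar t x‖ := norm_le_pi_norm _ j
    _ ≤ _ := hR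

/-- The elementwise sup norm of the identity matrix is at most one. [folklore] -/
theorem norm_one_matrix_le : ‖(1 : Matrix (Fin 3) (Fin 3) ℝ)‖ ≤ 1 := by
  rw [Matrix.norm_le_iff zero_le_one]
  intro i j
  rw [Matrix.one_apply]; split_ifs <;> simp

/-- **Confinement of `R̃_{q,i}` on the support of `η_i`** (crude form): for `C_in ≥ 0`, `a ≥ 1`
and `4δ_{q+2} ≤ δ_{q+1}λ_q^{-α}` (so that `ρ_q ≥ δ_{q+1}λ_q^{-α}/8 > 0`),
`‖R̃_{q,i}(t,x)‖_∞ ≤ 9 e^{8C_in}(1 + 8C_in)` wherever `η_i(t,·) ≠ 0` somewhere: by (5.32)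
`R̃ = ∇Φ (Id - (∑∫η²/ρ_q) R̊̄) ∇Φᵀ` with `‖∇Φ‖_∞ ≤ e^{4C_in}`, `∑∫η² ≤ 1`,
`‖R̊̄‖ ≤ C_in δ_{q+1} ℓ^α` and `λ_q^α ℓ^α ≤ 1`. [cite: BuckmasterEtAl2018, Lemma 5.4 (proof)] -/
theorem PerturbationData.norm_tildeR_le (H : PerturbationHypotheses P S Nbar Cin C₀)
    (𝒟 : PerturbationData P S c₀ Cη) (hCin : 0 ≤ Cin) (ha : 1 ≤ P.a) (hb : 1 ≤ P.b) (hβ : 0 ≤ P.β)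
    (hα : 0 ≤ P.α)
    (h4 : 4 * amp P.β P.a P.b (S.q + 2) ≤ amp P.β P.a P.b (S.q + 1) * freq P.a P.b S.q ^ (-P.α))
    {i : ℕ} {t : ℝ} (ht : t ∈ Icc 0 S.T) {x' : UnitAddTorus (Fin 3)} (hη : 𝒟.cut.η i t x' ≠ 0)
    (x : UnitAddTorus (Fin 3)) :
    ‖tildeR P S 𝒟.cut.η 𝒟.D i t x‖ ≤ 9 * Real.exp (8 * Cin) * (1 + 8 * Cin) := by
  set G := gradPhi 𝒟.D i t x with hG
  set M : Matrix (Fin 3) (Fin 3) ℝ :=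
    1 - (etaMass P S 𝒟.cut.η t / rhoQ P S t) • ofCols (S.Rbar t x) with hM
  have hGle : ‖G‖ ≤ Real.exp (4 * Cin) := 𝒟.norm_gradPhi_le H hCin ha hb hβ hα ht hη x
  have hGt : ‖Gᵀ‖ ≤ Real.exp (4 * Cin) := by rw [Matrix.norm_transpose]; exact hGle
  -- the scalar `c = ∑∫η² / ρ_q`
  have hδ : 0 < amp P.β P.a P.b (S.q + 1) := amp_pos ha _
  have hfa : 0 < freq P.a P.b S.q ^ (-P.α) := Real.rpow_pos_of_pos (freq_pos ha _) _
  have hρlow := H.le_rhoQ h4 ht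
  have hρpos : 0 < rhoQ P S t := lt_of_lt_of_le (by positivity) hρlow
  have hm0 : 0 ≤ etaMass P S 𝒟.cut.η t := by
    unfold etaMass
    exact Finset.sum_nonneg fun j _ => integral_nonneg fun y => sq_nonneg _
  have hm1 : etaMass P S 𝒟.cut.η t ≤ 1 := 𝒟.etaMass_le_one ht
  have hc0 : 0 ≤ etaMass P S 𝒟.cut.η t / rhoQ P S t := div_nonneg hm0 hρpos.le
  have hc : etaMass P S 𝒟.cut.η t / rhoQ P S t ≤
      8 * freq P.a P.b S.q ^ P.α / amp P.β P.a P.b (S.q + 1) := by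
    rw [div_le_div_iff₀ hρpos hδ]
    have hinv : freq P.a P.b S.q ^ P.α * freq P.a P.b S.q ^ (-P.α) = 1 := by
      rw [← Real.rpow_add (freq_pos ha _), add_neg_cancel, Real.rpow_zero]
    calc etaMass P S 𝒟.cut.η t * amp P.β P.a P.b (S.q + 1)
        ≤ 1 * amp P.β P.a P.b (S.q + 1) := mul_le_mul_of_nonneg_right hm1 hδ.le
      _ = 8 * freq P.a P.b S.q ^ P.α *
          (amp P.β P.a P.b (S.q + 1) * freq P.a P.b S.q ^ (-P.α) / 8) := by
          rw [one_mul]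
          calc amp P.β P.a P.b (S.q + 1)
              = amp P.β P.a P.b (S.q + 1) *
                  (freq P.a P.b S.q ^ P.α * freq P.a P.b S.q ^ (-P.α)) := by
                rw [hinv, mul_one]
            _ = _ := by ring
      _ ≤ 8 * freq P.a P.b S.q ^ P.α * rhoQ P S t :=
          mul_le_mul_of_nonneg_left hρlow
            (mul_nonneg (by norm_num) (Real.rpow_nonneg (freq_pos ha _).le _))
  -- `‖c • ofCols R̊̄‖ ≤ 8 C_in`
  have hR := H.norm_ofCols_Rbar_le hCin ha ht x
  have hcR : ‖(etaMass P S 𝒟.cut.η t / rhoQ P S t) • ofCols (S.Rbar t x)‖ ≤ 8 * Cin := by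
    rw [norm_smul, Real.norm_eq_abs, abs_of_nonneg hc0]
    have hprod := freq_rpow_mul_mollScale_rpow_le_one₁ ha hb hβ hα S.q (β := P.β)
    calc etaMass P S 𝒟.cut.η t / rhoQ P S t * ‖ofCols (S.Rbar t x)‖
        ≤ (8 * freq P.a P.b S.q ^ P.α / amp P.β P.a P.b (S.q + 1)) *
            (Cin * (amp P.β P.a P.b (S.q + 1) * mollScale P.β P.α P.a P.b S.q ^ P.α)) :=
          mul_le_mul hc hR (norm_nonneg _)
            (div_nonneg (mul_nonneg (by norm_num) (Real.rpow_nonneg (freq_pos ha _).le _)) hδ.le)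
      _ = 8 * Cin * (freq P.a P.b S.q ^ P.α * mollScale P.β P.α P.a P.b S.q ^ P.α) := by
          field_simp
      _ ≤ 8 * Cin * 1 := mul_le_mul_of_nonneg_left hprod (by positivity)
      _ = 8 * Cin := mul_one _
  have hMle : ‖M‖ ≤ 1 + 8 * Cin :=
    (norm_sub_le _ _).trans (add_le_add norm_one_matrix_le hcR)
  -- assemble `‖G M Gᵀ‖ ≤ 3 ‖G M‖ ‖Gᵀ‖ ≤ 9 ‖G‖ ‖M‖ ‖Gᵀ‖`
  have hexp0 : 0 ≤ Real.exp (4 * Cin) := (Real.exp_pos _).le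
  have hM0 : 0 ≤ 1 + 8 * Cin := by linarith
  have h1 : ‖G * M‖ ≤ 3 * Real.exp (4 * Cin) * (1 + 8 * Cin) :=
    (norm_matrix_mul_le G M).trans (by gcongr)
  have h2 : ‖G * M * Gᵀ‖ ≤ 3 * (3 * Real.exp (4 * Cin) * (1 + 8 * Cin)) * Real.exp (4 * Cin) :=
    (norm_matrix_mul_le (G * M) Gᵀ).trans (by gcongr)
  have hexp : Real.exp (4 * Cin) * Real.exp (4 * Cin) = Real.exp (8 * Cin) := by
    rw [← Real.exp_add]; ring_nf
  calc ‖tildeR P S 𝒟.cut.η 𝒟.D i t x‖ = ‖G * M * Gᵀ‖ := by rw [tildeR]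
    _ ≤ 3 * (3 * Real.exp (4 * Cin) * (1 + 8 * Cin)) * Real.exp (4 * Cin) := h2
    _ = 9 * Real.exp (8 * Cin) * (1 + 8 * Cin) := by rw [← hexp]; ring

/-- **`|ρ_{q,i}^{1/2}| ≤ (δ_{q+1}/c₀)^{1/2}`** on `[0,T] × T³` (Lemma 5.4: `ρ_q ≤ δ_{q+1}`,
`∑_j∫η_j² ≥ c₀ > 0`, `0 ≤ η_i ≤ 1`). [cite: BuckmasterEtAl2018, Lemma 5.4] -/
theorem PerturbationData.abs_sqrtRhoI_le (H : PerturbationHypotheses P S Nbar Cin C₀)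
    (𝒟 : PerturbationData P S c₀ Cη) (hc₀ : 0 < c₀) (ha : 1 ≤ P.a) {t : ℝ} (ht : t ∈ Icc 0 S.T)
    (i : ℕ) (x : UnitAddTorus (Fin 3)) :
    |sqrtRhoI P S 𝒟.cut.η i t x| ≤ Real.sqrt (amp P.β P.a P.b (S.q + 1) / c₀) := by
  have hm : c₀ ≤ etaMass P S 𝒟.cut.η t := 𝒟.le_etaMass ht
  have hm0 : 0 < etaMass P S 𝒟.cut.η t := hc₀.trans_le hm
  have hq : rhoQ P S t / etaMass P S 𝒟.cut.η t ≤ amp P.β P.a P.b (S.q + 1) / c₀ :=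
    calc rhoQ P S t / etaMass P S 𝒟.cut.η t
        ≤ amp P.β P.a P.b (S.q + 1) / etaMass P S 𝒟.cut.η t :=
          div_le_div_of_nonneg_right (H.rhoQ_le ha ht) hm0.le
      _ ≤ amp P.β P.a P.b (S.q + 1) / c₀ :=
          div_le_div_of_nonneg_left (amp_pos ha _).le hc₀ hm
  have hη0 := 𝒟.cut.nonneg i t x
  have hη1 := 𝒟.cut.le_one i t x
  rw [sqrtRhoI, abs_mul, abs_of_nonneg hη0, abs_of_nonneg (Real.sqrt_nonneg _)]
  calc 𝒟.cut.η i t x * Real.sqrt (rhoQ P S t / etaMass P S 𝒟.cut.η t)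
      ≤ 1 * Real.sqrt (amp P.β P.a P.b (S.q + 1) / c₀) :=
        mul_le_mul hη1 (Real.sqrt_le_sqrt hq) (Real.sqrt_nonneg _) zero_le_one
    _ = _ := one_mul _

end Pointwise

/-! ## The discharge of G₁ -/

section Discharge

variable {P : Params} {S : Setting} {Nbar : ℕ} {Cin C₀ c₀ : ℝ} {Cη : ℕ → ℕ → ℝ}

/-- **The cross-term bound at fixed parameters** (the heart of the first estimate of the proof of
Prop. 6.2): under the standing hypotheses with `C_in ≥ 0`, `c₀ > 0`, `a ≥ 1` and
`4δ_{q+2} ≤ δ_{q+1}λ_q^{-α}`, if the Mikado potential is bounded by `K_V` on the ball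
`‖R‖_∞ ≤ 9e^{8C_in}(1 + 8C_in)`, then
`|∫ ⟪w_{q+1}, v̄_q⟫| ≤ (2π · 54 · e^{4C_in} K_V C_in / c₀^{1/2}) · δ_q^{1/2} δ_{q+1}^{1/2} λ_q λ_{q+1}⁻¹`
on `[0,T]`. [cite: BuckmasterEtAl2018, Prop. 6.2 (proof, estimate of ∫ w_{q+1}·v̄_q)] -/
theorem PerturbationData.abs_integral_inner_perturbation_vbar_le
    (H : PerturbationHypotheses P S Nbar Cin C₀) (𝒟 : PerturbationData P S c₀ Cη)
    (𝔚 : MikadoDatum mikadoRadius) (hc₀ : 0 < c₀) (hCin : 0 ≤ Cin) (ha : 1 ≤ P.a) (hb : 1 ≤ P.b)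
    (hβ : 0 ≤ P.β) (hα : 0 ≤ P.α)
    (h4 : 4 * amp P.β P.a P.b (S.q + 2) ≤ amp P.β P.a P.b (S.q + 1) * freq P.a P.b S.q ^ (-P.α))
    {KV : ℝ} (hKV0 : 0 ≤ KV)
    (hKV : ∀ R ∈ Metric.closedBall (0 : Matrix (Fin 3) (Fin 3) ℝ)
      (9 * Real.exp (8 * Cin) * (1 + 8 * Cin)), ∀ ξ : UnitAddTorus (Fin 3), ‖𝔚.V R ξ‖ ≤ KV)
    {t : ℝ} (ht : t ∈ Icc 0 S.T) :
    |∫ x, ⟪perturbation P S 𝔚 𝒟.cut.η 𝒟.D t x, S.vbar t x⟫_ℝ| ≤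
      (2 * Real.pi * 54 * Real.exp (4 * Cin) * KV * Cin / Real.sqrt c₀) *
        (Real.sqrt (amp P.β P.a P.b S.q) * Real.sqrt (amp P.β P.a P.b (S.q + 1)) *
          freq P.a P.b S.q * (freq P.a P.b (S.q + 1))⁻¹) := by
  -- positivity of `ρ_q`, smoothness
  have hρpos : ∀ s ∈ Icc 0 S.T, 0 < rhoQ P S s := fun s hs =>
    lt_of_lt_of_le (div_pos (mul_pos (amp_pos ha _) (Real.rpow_pos_of_pos (freq_pos ha _) _))
      (by norm_num)) (H.le_rhoQ h4 hs)
  have hSD : SmoothData P S 𝒟.cut.η 𝒟.D := H.toSmoothData hc₀ 𝒟 hρpos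
  have hZ : IsSmooth (potential P S 𝔚 𝒟.cut.η 𝒟.D t) := (hSD.potential 𝔚).isSmooth_slice ht
  have hv : IsSmooth (S.vbar t) := H.eulerReynolds.smooth_velocity.isSmooth_slice ht
  -- Step 1: `∫ ⟪w, v̄⟫ = n⁻¹ ∫ ⟪Z, curl v̄⟫`
  set n : ℕ := P.freqNat (S.q + 1) with hn
  have hw : (fun x => ⟪perturbation P S 𝔚 𝒟.cut.η 𝒟.D t x, S.vbar t x⟫_ℝ) =
      fun x => ((n : ℝ))⁻¹ * ⟪curl (potential P S 𝔚 𝒟.cut.η 𝒟.D t) x, S.vbar t x⟫_ℝ := by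
    funext x
    rw [perturbation, real_inner_smul_left]
  have hI : ∫ x, ⟪perturbation P S 𝔚 𝒟.cut.η 𝒟.D t x, S.vbar t x⟫_ℝ =
      ((n : ℝ))⁻¹ * ∫ x, ⟪potential P S 𝔚 𝒟.cut.η 𝒟.D t x, curl (S.vbar t) x⟫_ℝ := by
    rw [hw, integral_const_mul, integral_inner_curl_comm hZ hv]
  -- Step 2: `‖curl v̄‖ ≤ 6 C_in δ_q^{1/2} λ_q`
  have hcurl : ∀ x, ‖curl (S.vbar t) x‖ ≤
      6 * (Cin * (Real.sqrt (amp P.β P.a P.b S.q) * freq P.a P.b S.q)) := by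
    intro x
    refine norm_curl_le fun j => ?_
    have hvj := H.velocity 0 (Nat.zero_le _) t ht
    simp only [Nat.cast_zero, neg_zero, Real.rpow_zero, mul_one, zero_add] at hvj
    exact norm_partialDeriv_le_of_eContDiffHolderNorm_le (hv.isContDiff (by simp))
      (mul_nonneg hCin (mul_nonneg (Real.sqrt_nonneg _) (freq_pos ha _).le)) hvj j x
  -- Step 3: `‖Z‖ ≤ (δ_{q+1}/c₀)^{1/2} · 9 e^{4C_in} · K_V`
  set KZ : ℝ := Real.sqrt (amp P.β P.a P.b (S.q + 1) / c₀) * (9 * Real.exp (4 * Cin) * KV)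
    with hKZ
  have hKZ0 : 0 ≤ KZ := by positivity
  have hZle : ∀ x, ‖potential P S 𝔚 𝒟.cut.η 𝒟.D t x‖ ≤ KZ := by
    intro x
    refine 𝒟.cut.norm_sum_le t x hKZ0
      (fun i hi => by rw [sqrtRhoI, hi, zero_mul, zero_smul]) ?_ _
    intro i
    by_cases hη : 𝒟.cut.η i t x = 0
    · rw [sqrtRhoI, hη, zero_mul, zero_smul, norm_zero]
      exact hKZ0
    · rw [norm_smul, Real.norm_eq_abs]
      have h1 := 𝒟.abs_sqrtRhoI_le H hc₀ ha ht i x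
      have hG : ‖(gradPhi 𝒟.D i t x)ᵀ‖ ≤ Real.exp (4 * Cin) := by
        rw [Matrix.norm_transpose]
        exact 𝒟.norm_gradPhi_le H hCin ha hb hβ hα ht hη x
      have hRt : tildeR P S 𝒟.cut.η 𝒟.D i t x ∈
          Metric.closedBall (0 : Matrix (Fin 3) (Fin 3) ℝ)
            (9 * Real.exp (8 * Cin) * (1 + 8 * Cin)) := by
        rw [Metric.mem_closedBall, dist_zero_right]
        exact 𝒟.norm_tildeR_le H hCin ha hb hβ hα h4 ht hη x
      have hVle := hKV _ hRt (n • phiPoint 𝒟.D i t x)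
      have h2 := norm_toEuclideanLin_le (gradPhi 𝒟.D i t x)ᵀ
        (𝔚.V (tildeR P S 𝒟.cut.η 𝒟.D i t x) (n • phiPoint 𝒟.D i t x))
      have h3 : 9 * ‖(gradPhi 𝒟.D i t x)ᵀ‖ *
          ‖𝔚.V (tildeR P S 𝒟.cut.η 𝒟.D i t x) (n • phiPoint 𝒟.D i t x)‖ ≤
          9 * Real.exp (4 * Cin) * KV :=
        mul_le_mul (mul_le_mul_of_nonneg_left hG (by norm_num)) hVle (norm_nonneg _)
          (by positivity)
      calc |sqrtRhoI P S 𝒟.cut.η i t x| *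
            ‖Matrix.toEuclideanLin (gradPhi 𝒟.D i t x)ᵀ
              (𝔚.V (tildeR P S 𝒟.cut.η 𝒟.D i t x) (n • phiPoint 𝒟.D i t x))‖
          ≤ Real.sqrt (amp P.β P.a P.b (S.q + 1) / c₀) * (9 * Real.exp (4 * Cin) * KV) :=
            mul_le_mul h1 (h2.trans h3) (norm_nonneg _) (Real.sqrt_nonneg _)
        _ = KZ := rfl
  -- Step 4: put together
  have hfreq : freq P.a P.b (S.q + 1) = 2 * Real.pi * (n : ℝ) := by
    rw [hn]
    exact P.freq_eq (by linarith) (S.q + 1)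
  have hn0 : (0 : ℝ) < n := by
    have hf := freq_pos (b := P.b) ha (S.q + 1)
    rw [hfreq] at hf
    exact pos_of_mul_pos_right hf (by positivity)
  have hninv : ((n : ℝ))⁻¹ = 2 * Real.pi * (freq P.a P.b (S.q + 1))⁻¹ := by
    rw [hfreq]
    field_simp
  have hint := abs_integral_inner_le hZle hcurl hKZ0
  rw [hI, abs_mul, abs_of_pos (inv_pos.2 hn0), hninv]
  have hsq : Real.sqrt (amp P.β P.a P.b (S.q + 1) / c₀) =
      Real.sqrt (amp P.β P.a P.b (S.q + 1)) / Real.sqrt c₀ :=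
    Real.sqrt_div (amp_pos ha _).le c₀
  have hf1 : 0 ≤ (freq P.a P.b (S.q + 1))⁻¹ := inv_nonneg.2 (freq_pos ha _).le
  have hc0' : Real.sqrt c₀ ≠ 0 := (Real.sqrt_pos.2 hc₀).ne'
  calc 2 * Real.pi * (freq P.a P.b (S.q + 1))⁻¹ *
        |∫ x, ⟪potential P S 𝔚 𝒟.cut.η 𝒟.D t x, curl (S.vbar t) x⟫_ℝ|
      ≤ 2 * Real.pi * (freq P.a P.b (S.q + 1))⁻¹ *
          (KZ * (6 * (Cin * (Real.sqrt (amp P.β P.a P.b S.q) * freq P.a P.b S.q)))) :=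
        mul_le_mul_of_nonneg_left hint (by positivity)
    _ = (2 * Real.pi * 54 * Real.exp (4 * Cin) * KV * Cin / Real.sqrt c₀) *
        (Real.sqrt (amp P.β P.a P.b S.q) * Real.sqrt (amp P.β P.a P.b (S.q + 1)) *
          freq P.a P.b S.q * (freq P.a P.b (S.q + 1))⁻¹) := by
        rw [hKZ, hsq]
        field_simp
        ring

/-- **Discharge of G₁ `BDSV.energy_crossTerm`** (BDSV, proof of Prop. 6.2, first estimate):
along the common prefix, `|∫_{T³} ⟪w_{q+1}, v̄_q⟫ dx| ≤ C δ_q^{1/2} δ_{q+1}^{1/2} λ_q λ_{q+1}⁻¹` for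
every `t ∈ [0,T]`, with `α₀ = βb(b-1)`, `N̄ = 0`,
`C = 2π · 54 · e^{4C⁺} K_V C⁺ / c₀^{1/2}` (`C⁺ = max(C_in, 0)`, `K_V` the bound of the Mikado
potential on the ball `‖R‖_∞ ≤ 9e^{8C⁺}(1 + 8C⁺)`) and `a₀` the threshold of
`4δ_{q+2} ≤ δ_{q+1}λ_q^{-α}` (`BDSV.exists_threshold_four_amp`).
[cite: BuckmasterEtAl2018, Prop. 6.2 (proof, estimate of ∫ w_{q+1}·v̄_q)] -/
theorem energy_crossTerm_holds : energy_crossTerm := by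
  intro 𝔚 c₀ hc₀ Cη β hβ hβ' b hb hb'
  have hb0 : (0 : ℝ) < b := by linarith
  refine ⟨β * b * (b - 1), by nlinarith [mul_pos hβ hb0], fun α hα hαlt => ⟨0, fun Cin C₀ => ?_⟩⟩
  have hαb : α < 2 * β * b * (b - 1) := by nlinarith [mul_pos hβ hb0]
  obtain ⟨a₁, ha₁, hpar⟩ := exists_threshold_four_amp hb hαb
  have hCp0 : 0 ≤ max Cin 0 := le_max_right _ _
  obtain ⟨KV, hKV0, hKV⟩ := 𝔚.exists_bound_V
    (isCompact_closedBall (0 : Matrix (Fin 3) (Fin 3) ℝ)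
      (9 * Real.exp (8 * max Cin 0) * (1 + 8 * max Cin 0)))
  refine ⟨2 * Real.pi * 54 * Real.exp (4 * max Cin 0) * KV * max Cin 0 / Real.sqrt c₀, a₁, ha₁,
    fun a ha S H 𝒟 t ht => ?_⟩
  have ha1 : (1 : ℝ) ≤ a := ha₁.le.trans ha
  exact 𝒟.abs_integral_inner_perturbation_vbar_le (H.mono_const ha1 (le_max_left _ _)) 𝔚 hc₀
    hCp0 ha1 hb.le hβ.le hα.le (hpar a ha S.q) hKV0 hKV ht

end Discharge

end BDSV

end Literature.Analysis.FluidPDE
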